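import Summits.Ventures.HodgeRepro2.T5BergmanComplete
import Summits.Ventures.HodgeRepro2.T5BergmanKTypes
import Summits.Ventures.HodgeRepro2.T5BergmanProjection
import Summits.Ventures.HodgeRepro2.T5BergmanLadder
import Summits.Ventures.HodgeRepro2.T5BergmanSchurU11
import Summits.Ventures.HodgeRepro2.T5SU11CartanUnique

/-!
# The weighted Bergman model as a Hilbert-space representation — one entry point

The explicit model of the holomorphic discrete series of weight `k ≥ 2` of `SU(1,1)` on the tree
(`T5BergmanCoefficient.act` / `pairing`; `k = 3` is `π₃⁺` = Rühl's `(3/2, +)`, `T5BergmanRuhlModel`) is,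
by the files of §24–§25 of the p1 annex, a HILBERT-SPACE REPRESENTATION in the following kernel-checked
sense; this file only restates the headline theorems in one place (every proof is the cited one).

* **the space** `A_k = {f holomorphic on 𝔻 : ∫_𝔻 |f|² (1 - |z|²)^{k-2} dA < ∞}`: the pairing is
  positive-definite (`positive_definite`), the space is complete (`complete`), and the monomials
  `(5-98)` form an orthonormal basis after Rühl's normalisation (`orthonormal_system`, `parseval`,
  `taylor_tendsto`) — `A_k ≅ ℓ²` via `f ↦ (a_n √⟨zⁿ,zⁿ⟩_k)`;
* **the `K`-types**: each weight `k, k+2, …` exactly once (`ktype_at_most_once`, `no_other_weight`), the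
  Taylor truncation is the orthogonal projection (`projection_orthogonal`, `pythagoras`), and the ladder
  operators of the Lie algebra raise and lower the `K`-types (`ladder_raise`, `ladder_lower`);
* **the coherent states and the reproducing kernel** `K_z(w) = (1 - z̄ w)^{-k}`: `f(z) = (k-1)/π ⟨f, K_z⟩_k`
  (`reproducing`), `π_k(g) 1 = a^{-k} K_{g·0}` (`coherent_state`), the sharp pointwise bound
  (`pointwise_sharp`);
* **Schur orthogonality** with formal degree `k - 1 = 2 k_R - 1` for the pair `(1, h)`, `h ∈ A_k`, on
  `SU(1,1)` against `μ_R` (`schur`) and on `H_j = U(1,1)` against every Haar measure (`schur_U11`,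
  positive for `h ≠ 0`: `schur_U11_pos`);
* **the Cartan coordinates** `g = rot u · a_t · rot v` are unique up to the centre (`cartan_unique`).

Blind lane: Mathlib + the HodgeRepro2 prefix only; no sorry; axioms ⊆ {propext, Classical.choice,
Quot.sound}.
-/

namespace Summit.Ventures.HodgeRepro2.T5BergmanHilbertSpace

open MeasureTheory MeasureTheory.Measure Metric Filter Topology
open T5SU11Unimodular T5U11Unimodular T5U11Product T5SU11Fibration T5SU11Cartan T5SU11CoefficientL2
open T5BergmanCoefficient T5BergmanPairing T5BergmanMonomialNorm T5BergmanRuhlModel T5BergmanPointwise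
  T5BergmanComplete T5BergmanParseval T5BergmanKTypes T5BergmanFourier T5BergmanProjection
  T5BergmanKernel T5BergmanSchur T5BergmanSchurU11 T5BergmanLadder T5SU11CartanUnique
open scoped Real

/-- **Positive-definiteness**: `⟨f, f⟩_k = 0 ⟺ f ≡ 0` on `𝔻` for holomorphic `f ∈ A_k`. -/
theorem positive_definite (k : ℕ) (f : ℂ → ℂ) (hf : DifferentiableOn ℂ f (ball 0 1))
    (hint : IntegrableOn (fun w => ‖f w‖ ^ 2 * weight k w) (ball (0 : ℂ) 1)) :
    pairing k f f = 0 ↔ ∀ z ∈ ball (0 : ℂ) 1, f z = 0 :=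
  pairing_self_eq_zero_iff k f hf hint

/-- **Completeness**: every `⟨·,·⟩_k`-Cauchy sequence of `A_k` converges locally uniformly and in norm to a
holomorphic limit in `A_k`. -/
theorem complete (k : ℕ) (f : ℕ → ℂ → ℂ) (hf : ∀ j, DifferentiableOn ℂ (f j) (ball 0 1))
    (hint : ∀ j, IntegrableOn (fun w => ‖f j w‖ ^ 2 * weight k w) (ball (0 : ℂ) 1))
    (hcauchy : ∀ ε > 0, ∃ N, ∀ j ≥ N, ∀ l ≥ N, (pairing k (f j - f l) (f j - f l)).re < ε) :
    ∃ g : ℂ → ℂ, DifferentiableOn ℂ g (ball 0 1) ∧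
      IntegrableOn (fun w => ‖g w‖ ^ 2 * weight k w) (ball (0 : ℂ) 1) ∧
      TendstoLocallyUniformlyOn f g atTop (ball (0 : ℂ) 1) ∧
      Tendsto (fun j => (pairing k (f j - g) (f j - g)).re) atTop (𝓝 0) :=
  T5BergmanComplete.complete k f hf hint hcauchy

/-- **Rühl's `(5-98)/(5-99)` is an orthonormal system**: `(Φ_q, Φ_{q'}) = δ_{qq'}`. -/
theorem orthonormal_system (k : ℕ) (hk : 2 ≤ k) (n m : ℕ) :
    ruhlInner k (ruhlBasis k n) (ruhlBasis k m) = if n = m then 1 else 0 :=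
  ruhlInner_basis k hk n m

/-- **Parseval**: `⟨f, f⟩_k = Σ_n |f^{(n)}(0)/n!|² ⟨zⁿ, zⁿ⟩_k` for holomorphic `f ∈ A_k`. -/
theorem parseval (k : ℕ) (hk : 2 ≤ k) (f : ℂ → ℂ) (hf : DifferentiableOn ℂ f (ball 0 1))
    (hint : IntegrableOn (fun z => ‖f z‖ ^ 2 * (1 - ‖z‖ ^ 2) ^ (k - 2)) (ball (0 : ℂ) 1)) :
    HasSum (fun n => ‖taylorCoeff f n‖ ^ 2 * monomialNormSq k n) (pairing k f f).re :=
  hasSum_pairing_self_taylor k hk f hf hint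

/-- **The system is a basis**: the Taylor polynomials of `f ∈ A_k` converge to `f` in norm. -/
theorem taylor_tendsto (k : ℕ) (hk : 2 ≤ k) (f : ℂ → ℂ) (hf : DifferentiableOn ℂ f (ball 0 1))
    (hint : IntegrableOn (fun z => ‖f z‖ ^ 2 * (1 - ‖z‖ ^ 2) ^ (k - 2)) (ball (0 : ℂ) 1)) :
    Tendsto (fun N => (pairing k (f - partialSum (taylorCoeff f) N)
      (f - partialSum (taylorCoeff f) N)).re) atTop (𝓝 0) :=
  tendsto_pairing_sub_taylor k hk f hf hint

/-- **Each `K`-type at most once**: a holomorphic weight-`(k+2n)` vector on `𝔻` is `f^{(n)}(0)/n! · zⁿ`. -/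
theorem ktype_at_most_once (k n : ℕ) (f : ℂ → ℂ) (hf : DifferentiableOn ℂ f (ball 0 1))
    (hw : ∀ (u : Circle), ∀ z ∈ ball (0 : ℂ) 1,
      act k (rot u) f z = ((u : ℂ)⁻¹) ^ (k + 2 * n) * f z) :
    ∀ z ∈ ball (0 : ℂ) 1, f z = taylorCoeff f n * z ^ n :=
  eq_mul_monomial_of_weight_of_differentiableOn k n f hf hw

/-- **No other weights**: a weight vector of a weight not of the form `k + 2n` vanishes. -/
theorem no_other_weight (k j : ℕ) (f : ℂ → ℂ) (hf : DifferentiableOn ℂ f (ball 0 1))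
    (hw : ∀ (u : Circle), ∀ z ∈ ball (0 : ℂ) 1, act k (rot u) f z = ((u : ℂ)⁻¹) ^ j * f z)
    (hj : ∀ n, j ≠ k + 2 * n) : ∀ z ∈ ball (0 : ℂ) 1, f z = 0 :=
  eq_zero_of_weight_of_forall_ne k j _ f (hasSum_taylor f hf) hw hj

/-- **The Taylor truncation is the orthogonal projection**: `⟨f - S_N, S_N⟩_k = 0`. -/
theorem projection_orthogonal (k : ℕ) (hk : 2 ≤ k) (f : ℂ → ℂ) (hf : DifferentiableOn ℂ f (ball 0 1))
    (hint : IntegrableOn (fun z => ‖f z‖ ^ 2 * (1 - ‖z‖ ^ 2) ^ (k - 2)) (ball (0 : ℂ) 1)) (N : ℕ) :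
    pairing k (f - partialSum (taylorCoeff f) N) (partialSum (taylorCoeff f) N) = 0 :=
  pairing_sub_partialSum_partialSum k hk _ f (hasSum_taylor f hf) hint N

/-- **Pythagoras**: `⟨f, f⟩_k = ⟨S_N, S_N⟩_k + ⟨f - S_N, f - S_N⟩_k`. -/
theorem pythagoras (k : ℕ) (hk : 2 ≤ k) (f : ℂ → ℂ) (hf : DifferentiableOn ℂ f (ball 0 1))
    (hint : IntegrableOn (fun z => ‖f z‖ ^ 2 * (1 - ‖z‖ ^ 2) ^ (k - 2)) (ball (0 : ℂ) 1)) (N : ℕ) :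
    (pairing k f f).re =
      (pairing k (partialSum (taylorCoeff f) N) (partialSum (taylorCoeff f) N)).re +
        (pairing k (f - partialSum (taylorCoeff f) N) (f - partialSum (taylorCoeff f) N)).re :=
  T5BergmanProjection.pythagoras k hk _ f (hasSum_taylor f hf) hint N

/-- **The ladder raises**: `d/dt|₀ π_k(a_t) zⁿ + i · d/dt|₀ π_k(b_t) zⁿ = 2 (k + n) z^{n+1}`. -/
theorem ladder_raise (k n : ℕ) (w : ℂ) :
    deriv (fun t : ℝ => act k (hyp t) (fun z => z ^ n) w) 0 +
      Complex.I * deriv (fun t : ℝ => act k (hypB t) (fun z => z ^ n) w) 0 =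
      2 * (((k : ℂ) + n) * w ^ (n + 1)) := by
  rw [(hasDerivAt_act_hyp_monomial k n w).deriv, (hasDerivAt_act_hypB_monomial k n w).deriv]
  have := raise_monomial k n w
  linear_combination 2 * this

/-- **The ladder lowers**: `d/dt|₀ π_k(a_t) zⁿ - i · d/dt|₀ π_k(b_t) zⁿ = -2 n z^{n-1}` (so `1` is a
lowest-weight vector). -/
theorem ladder_lower (k n : ℕ) (w : ℂ) :
    deriv (fun t : ℝ => act k (hyp t) (fun z => z ^ n) w) 0 -
      Complex.I * deriv (fun t : ℝ => act k (hypB t) (fun z => z ^ n) w) 0 =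
      2 * (-(n : ℂ) * w ^ (n - 1)) := by
  rw [(hasDerivAt_act_hyp_monomial k n w).deriv, (hasDerivAt_act_hypB_monomial k n w).deriv]
  have := lower_monomial k n w
  linear_combination 2 * this

/-- **The reproducing formula**: `⟨f, K_z⟩_k = π/(k-1) · f(z)` for holomorphic `f ∈ A_k`, `z ∈ 𝔻`. -/
theorem reproducing (k : ℕ) (hk : 2 ≤ k) (f : ℂ → ℂ) (hf : DifferentiableOn ℂ f (ball 0 1))
    (hint : IntegrableOn (fun w => ‖f w‖ ^ 2 * (1 - ‖w‖ ^ 2) ^ (k - 2)) (ball (0 : ℂ) 1))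
    {z : ℂ} (hz : z ∈ ball (0 : ℂ) 1) :
    pairing k f (kernel k z) = ((π / ((k : ℝ) - 1) : ℝ) : ℂ) * f z :=
  pairing_kernel k hk _ f (hasSum_taylor f hf) hint hz

/-- **The coherent states**: `(π_k(g) 1)(w) = a^{-k} K_{g·0}(w)`. -/
theorem coherent_state (k : ℕ) (g : SU11) (w : ℂ) :
    act k g lowest w = (mat g 0 0)⁻¹ ^ k * kernel k (orbit g) w :=
  act_lowest_eq_kernel k g w

/-- **The sharp pointwise bound**: `|f(z)|² ≤ (k-1)/π · (1 - |z|²)^{-k} · ⟨f, f⟩_k`. -/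
theorem pointwise_sharp (k : ℕ) (hk : 2 ≤ k) (f : ℂ → ℂ) (hf : DifferentiableOn ℂ f (ball 0 1))
    (hint : IntegrableOn (fun w => ‖f w‖ ^ 2 * (1 - ‖w‖ ^ 2) ^ (k - 2)) (ball (0 : ℂ) 1))
    {z : ℂ} (hz : z ∈ ball (0 : ℂ) 1) :
    ‖f z‖ ^ 2 ≤ (((k : ℝ) - 1) / π) * (1 - ‖z‖ ^ 2)⁻¹ ^ k * (pairing k f f).re :=
  norm_sq_le_pairing_sharp k hk _ f (hasSum_taylor f hf) hint hz

variable [MeasurableSpace Circle] [BorelSpace Circle]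

/-- **Schur orthogonality on `SU(1,1)`** for the pair `(1, h)`, formal degree `k - 1`:
`∫_G |⟨π_k(g) 1, h⟩_k|² dμ_R = ⟨1, 1⟩_k ⟨h, h⟩_k / (k - 1)`. -/
theorem schur (k : ℕ) (hk : 2 ≤ k) (h : ℂ → ℂ) (hd : DifferentiableOn ℂ h (ball 0 1))
    (hint : IntegrableOn (fun w => ‖h w‖ ^ 2 * (1 - ‖w‖ ^ 2) ^ (k - 2)) (ball (0 : ℂ) 1)) :
    ∫ g, ‖coeffLowest k h g‖ ^ 2 ∂ruhl =
      (pairing k lowest lowest).re * (pairing k h h).re / ((k : ℝ) - 1) :=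
  integral_norm_coeffLowest_sq_ruhl_of_differentiableOn k hk h hd hint

variable [MeasurableSpace U11] [BorelSpace U11]

/-- **Schur orthogonality on `H_j = U(1,1)`** for the pair `(1, h)` against every Haar measure. -/
theorem schur_U11 (μU : Measure U11) [IsHaarMeasure μU] (k : ℕ) (hk : 2 ≤ k) (h : ℂ → ℂ)
    (hd : DifferentiableOn ℂ h (ball 0 1))
    (hint : IntegrableOn (fun w => ‖h w‖ ^ 2 * (1 - ‖w‖ ^ 2) ^ (k - 2)) (ball (0 : ℂ) 1)) :
    (haarScalarFactor (Measure.map mulHom (T5HaarCircle.haarCircle.prod (T5SU11FibrationHaar.nu T5HaarCircle.haarCircle))) μU : ℝ) •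
      ∫ g, ‖coeffLowestU k h g‖ ^ 2 ∂μU = (π / ((k : ℝ) - 1)) ^ 2 * (pairing k h h).re :=
  integral_norm_coeffLowestU_sq μU k hk _ h (hasSum_taylor h hd) hint

/-- **P3's `Z > 0` over `H_j`** for every `h ≠ 0` in the space and every weight. -/
theorem schur_U11_pos (μU : Measure U11) [IsHaarMeasure μU] (k : ℕ) (hk : 2 ≤ k) (h : ℂ → ℂ)
    (hd : DifferentiableOn ℂ h (ball 0 1))
    (hint : IntegrableOn (fun w => ‖h w‖ ^ 2 * (1 - ‖w‖ ^ 2) ^ (k - 2)) (ball (0 : ℂ) 1))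
    (hne : 0 < (pairing k h h).re) :
    0 < ∫ g, ‖coeffLowestU k h g‖ ^ 2 ∂μU :=
  integral_norm_coeffLowestU_sq_pos μU k hk _ h (hasSum_taylor h hd) hint hne

omit [MeasurableSpace U11] [BorelSpace U11] in
/-- **`π₃⁺` (weight `3`, Rühl's `(3/2, +)`)**: Schur orthogonality with formal degree `2` for the pair `(1, h)`:
`∫_G |⟨π₃(g) 1, h⟩|² dμ_R = (π/2) ⟨h, h⟩₃ / 2`. -/
theorem schur_three (h : ℂ → ℂ) (hd : DifferentiableOn ℂ h (ball 0 1))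
    (hint : IntegrableOn (fun w => ‖h w‖ ^ 2 * (1 - ‖w‖ ^ 2) ^ (3 - 2)) (ball (0 : ℂ) 1)) :
    ∫ g, ‖coeffLowest 3 h g‖ ^ 2 ∂ruhl = (π / 2) * (pairing 3 h h).re / 2 := by
  rw [schur 3 (by norm_num) h hd hint, pairing_lowest_lowest_three, Complex.ofReal_re]
  norm_num

omit [MeasurableSpace Circle] [BorelSpace Circle] [MeasurableSpace U11] [BorelSpace U11] in
/-- **`π₃⁺`**: the reproducing formula `⟨f, K_z⟩₃ = (π/2) f(z)`, `K_z(w) = (1 - z̄ w)^{-3}`. -/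
theorem reproducing_three (f : ℂ → ℂ) (hf : DifferentiableOn ℂ f (ball 0 1))
    (hint : IntegrableOn (fun w => ‖f w‖ ^ 2 * (1 - ‖w‖ ^ 2) ^ (3 - 2)) (ball (0 : ℂ) 1))
    {z : ℂ} (hz : z ∈ ball (0 : ℂ) 1) :
    pairing 3 f (kernel 3 z) = ((π / 2 : ℝ) : ℂ) * f z := by
  rw [reproducing 3 (by norm_num) f hf hint hz]
  norm_num

omit [MeasurableSpace Circle] [BorelSpace Circle] [MeasurableSpace U11] [BorelSpace U11] in
/-- **The Cartan coordinates are unique up to the centre**. -/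
theorem cartan_unique {u v u' v' : Circle} {t t' : ℝ} (ht : 0 < t) (ht' : 0 ≤ t')
    (hg : rot u * hyp t * rot v = rot u' * hyp t' * rot v') :
    t = t' ∧ ((u = u' ∧ v = v') ∨ (u = -u' ∧ v = -v')) := by
  have htt := t_unique ht.le ht' hg
  subst htt
  exact ⟨rfl, angles_unique ht.ne' hg⟩

end Summit.Ventures.HodgeRepro2.T5BergmanHilbertSpace
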